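import Summits.BirchSwinnertonDyer.Rank1Residual.GaloisImage.CanonicalComparisonInverseGenerator
import Summits.BirchSwinnertonDyer.Rank1Residual.GaloisImage.KatoKuriharaPortThreeWith
import Summits.BirchSwinnertonDyer.Rank1Residual.GaloisImage.KolyvaginSystemRestriction
import Summits.BirchSwinnertonDyer.Rank1Residual.GaloisImage.PropagatedStructureUnramified
import Summits.BirchSwinnertonDyer.Rank1Residual.GaloisImage.SakamotoN11InstanceResidual
import HarnessLib

/-!
# The SECOND anomaly check on the repaired PORT′ `KatoKuriharaPortThreeAtWith`: relative consistency
# of its equal-depth slice (TOOL; cell `b2b-bsdres`, team n1011, seat p11 GEN 14; referee A R168.5 /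
# R169.5 / R170.6 — "same `η`, different prime sets at `k = k′`; datum vs sub-datum"; row T-PORT-NEG N4)

HONEST FRAMING (run/shared/lean/b2b/bsd-rank1-residual/, verbatim in every file): the goal of the
cell is to DELETE the COMBINATION-SHAPED residual classes of the Birch–Swinnerton-Dyer formula for
ALL analytic-rank `≤ 1` elliptic curves over `ℚ` — "full BSD formula for every rank `≤ 1` curve in
class `C`" assembled STRICTLY from published theorems — so that the rank-`≤ 1` remainder becomes
exactly the CONSTRUCTION-SHAPED classes, which are TYPED (missing-input `Prop`s), NOT attempted.
This is not "finishing BSD".  Team n1011 (N10/N11, the additive block `X4 ∧ p = 3`): research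
route on the CONSTRUCTION-SHAPED class X4 / §I N11 (route-1 PORT); TOOL theorems only — no class
theorem, nothing booked, no mark / label / count moved; no definition, no named fact, no `sorry`.
PORT′ / PORT″ stay FLAGGED missing inputs (`K22-Thm3.13-PORT@3`, never `_holds`); NO instance of
them is proved here.  What is proved is RELATIVE CONSISTENCY: the PORT′ instances named in the
referee's second check FOLLOW from the single-datum dictionary DICT3 (`KatoKuriharaDictionaryThreeAt`,
p09), so they cannot be refuted without refuting DICT3 itself, and the generator-sign lever of this
lineage's T-PORT-NEG (N1 `CanonicalComparisonInverseGenerator`, N2 `KatoKuriharaPortThreeRefutation`: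
data over `η` and `η⁻¹` have OPPOSITE comparison maps on `H¹_ur`) has nothing to act on.

* §1–§2 ★ `fs_eq_fs_of_hasCanonicalComparison`: two data canonical for the SAME `η` have the SAME
  comparison maps on `H¹_ur(ℚ_𝔮, M)` at every common prime (`w(τ) = Q(φ⁻¹) z(φ) = w′(τ)` on the
  `η`-fibre of inertia, so `[w′ − w]` is unramified) — and `H¹_ur` is all the Kolyvagin relations see.
* §3–§4: the witness clauses (0), (I4), (Λ), (DICT3) of DICT3 pass from a datum to every sub-datum
  with the SAME `κ`, the SAME `Λ` and `κ′` restricted (T-KS-RES `KolyvaginSystemRestriction`,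
  sharpened to maps agreeing on `H¹_ur` only); for DISJOINT prime sets (COMP) at `k = k′` is EXACTLY
  the agreement of the bottom classes (`comp_id_iff_apply_empty_of_disjoint`).
* §5 ★★★ `dictionaryThreeAt₂_of_dictionaryThreeAt[_of_with]`: DICT3 at ONE With-guarded datum `D`
  gives `KatoKuriharaDictionaryThreeAt₂ W t k k D₁ D₂ red v₃` for ANY two data `D₁, D₂ ⊆ D` guarded
  for the same `η` and EVERY `red` (the pin makes `red = id`, `eq_id_of_pin`) — case (b) in both
  orientations (`D₁ = D` / `D₂ = D`) and case (a) inside a common class; conversely PORT′ gives DICT3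
  at every guarded datum (`dictionaryThreeAt_of_portWith`): on such pairs PORT′ and DICT3 have THE
  SAME content.  §6 ★★ `dictionaryThreeAt₂_of_uniform`: ONE family `(κ, Λ, κ′)` for every datum
  guarded for `η` (the shape of Kato's `κ_n^{η}` for a FIXED `η`, [Kim22] §2.2.2) gives EVERY
  equal-depth instance, disjoint classes included — PORT′'s content at `k = k′` beyond DICT3 is the
  GLUING of families across data, which no clause of the predicate can contradict.

NOT here (honest): the pairs `k < k′` (reduction by `3^{k′−k}`; no sign lever since `η` is shared,
no relative-consistency theorem offered); satisfiability of DICT3 / PORT′ / PORT″ ([K22] Thm. 3.13 is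
printed for `p ≥ 5`); the dichotomy "two `τ`-classes at one modulus are disjoint or equal off
`S₁ ∪ S₂`" that sorts case (a) into §5 or §6 in the prose (no theorem below needs it).
References: [Kim2022StructureSelmer] §2.1.2, §2.2.2, Thm. 3.13; [Rubin2011] Def. 1.9.6, Prop. 1.9.5,
Def. 2.2.1; [Sakamoto2024] Def. 4.1; [MazurRubin2004] Def. 3.1.3; [SilvermanAEC2009] Prop. VII.4.1 (a);
cells/n1011/PLAN.md R5-110 (n1)–(n4); HOME/REFEREE.md R168.5 / R169.5 / R170.6;
`HOME/b2b-bsdres-n1011-p11/gen11/PORT-ANOMALY.md`, `…/gen14/PORT2-ANOMALY-CHECK.md`.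
-/

noncomputable section

open scoped Classical NumberField ContRepresentation
open Field NumberField IsDedekindDomain WeierstrassCurve
open Literature.NumberTheory.EllipticCurves Literature.NumberTheory.EllipticCurves.ModularForms
open Literature.NumberTheory.EllipticCurves.Rank1Residual
open Literature.NumberTheory.GaloisRepresentations
open Literature.NumberTheory.GaloisRepresentations.DiscreteGaloisModule
open Literature.NumberTheory.GaloisCohomology

universe u

namespace Summit.BirchSwinnertonDyer.Rank1Residual.GaloisImage.PortCheck

section Local
variable {F : Type u} [Field F] [ValuativeRel F] [TopologicalSpace F] [IsNonarchimedeanLocalField F]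
variable {M : Type u} [AddCommGroup M] [TopologicalSpace M] [DiscreteTopology M]
variable (ρ : DiscreteGaloisModule F M) (N : ℕ) [Module (ZMod N) M] [Module.Free (ZMod N) M]
  [Module.Finite (ZMod N) M]

/-- **Two finite–singular comparison maps computed over the SAME generator coincide on `H¹_ur`**
(inertia acting trivially on `M`; `fs`, `fs′` both computed with `(φ, τ)` for every inertia `τ` over
the generator `η`): `w(τ) = Q(φ⁻¹) z(φ) = w′(τ)`, so a representative of `fs′ x − fs x` vanishes on
the `η`-fibre of inertia, hence on inertia, i.e. is unramified.  Same-generator twin of N1's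
`fs_add_fs_eq_zero_of_isFiniteSingularComparisonWith_inv`.
[cite: Rubin2011, Def. 1.9.6 and Prop. 1.9.5 (p. 14)] [cite: Kim2022StructureSelmer, §2.1.2 and §2.2.2] -/
theorem fs_eq_fs_of_isFiniteSingularComparisonWith
    (hI : ∀ τ ∈ absInertia F, ρ τ = 1)
    {G : Type*} [Group G] (χ : absoluteGaloisGroup F →* G) {η : G}
    (hgen : Subgroup.zpowers η = ⊤) (hτ₀ : ∃ τ₀ ∈ absInertia F, χ τ₀ = η)
    (φ : absoluteGaloisGroup F) {fs fs' : galoisCohomology ρ 1 →+ ρ.SingularQuotient}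
    (hfs : ∀ τ ∈ absInertia F, χ τ = η → ρ.IsFiniteSingularComparisonWith N fs φ τ)
    (hfs' : ∀ τ ∈ absInertia F, χ τ = η → ρ.IsFiniteSingularComparisonWith N fs' φ τ)
    {x : galoisCohomology ρ 1} (hx : x ∈ unramifiedSubgroup ρ 1) :
    fs' x = fs x := by
  have hI' : ∀ τ ∈ absInertia F, ∀ m : M, ρ τ m = m := fun τ hτ m => by
    rw [hI τ hτ, Module.End.one_apply]
  obtain ⟨z, rfl⟩ := oneCocycleClass_surjective ρ.toTopRep x
  obtain ⟨c, hc⟩ := QuotientAddGroup.mk_surjective (fs (oneCocycleClass ρ.toTopRep z))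
  obtain ⟨w, rfl⟩ := oneCocycleClass_surjective ρ.toTopRep c
  obtain ⟨c', hc'⟩ := QuotientAddGroup.mk_surjective (fs' (oneCocycleClass ρ.toTopRep z))
  obtain ⟨w', rfl⟩ := oneCocycleClass_surjective ρ.toTopRep c'
  have hw : ρ.singularMap (oneCocycleClass ρ.toTopRep w) = fs (oneCocycleClass ρ.toTopRep z) := hc
  have hw' : ρ.singularMap (oneCocycleClass ρ.toTopRep w') = fs' (oneCocycleClass ρ.toTopRep z) := hc'
  -- `w′ − w` vanishes on the `η`-fibre of inertia, hence on inertia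
  have hvan : ∀ τ ∈ absInertia F, (w' - w).1 τ = 0 := by
    refine KSDevissage.forall_absInertia_apply_eq_zero_of_fibre ρ hI χ hgen hτ₀ (w' - w)
      fun τ hτ hχτ => ?_
    have h1 : w.1 τ = ρ.comparisonOp N φ (z.1 φ) := (hfs τ hτ hχτ).apply_eq z w hx hw
    have h2 : w'.1 τ = ρ.comparisonOp N φ (z.1 φ) := (hfs' τ hτ hχτ).apply_eq z w' hx hw'
    rw [Submodule.coe_sub, ContinuousMap.sub_apply, h1, h2, sub_self]
  have hur : oneCocycleClass ρ.toTopRep (w' - w) ∈ unramifiedSubgroup ρ 1 :=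
    (X11b.LocBridge.mem_unramifiedSubgroup_one_iff_forall_eq_zero ρ hI' _).mpr hvan
  have h0 : ρ.singularMap (oneCocycleClass ρ.toTopRep (w' - w)) = 0 :=
    (singularMap_eq_zero_iff ρ _).mpr hur
  have key : ρ.singularMap (oneCocycleClass ρ.toTopRep w') =
      ρ.singularMap (oneCocycleClass ρ.toTopRep w) := by
    have h := FSComp.singularMap_oneCocycleClass_add (ρ := ρ) (w' - w) w
    rw [sub_add_cancel, h0, zero_add] at h
    exact h
  rw [← hw, ← hw', key]

end Local

section Rat
variable {M : Type} [AddCommGroup M] [TopologicalSpace M] [DiscreteTopology M]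
  {ρ : DiscreteGaloisModule ℚ M} {N : ℕ}
  [Module (ZMod N) M] [Module.Free (ZMod N) M] [Module.Finite (ZMod N) M]

/-- ★ **Two Kolyvagin data canonical for the SAME primitive roots `η` have the SAME comparison maps on
`H¹_ur(ℚ_𝔮, M)` at every common prime `𝔮` where `M` is unramified** (`HasCanonicalComparison N η`
pins `D.fs 𝔮` on `H¹_ur`, the whole domain the Kolyvagin relations use).  No sign lever — contrast
N1's `fs_eq_neg_fs_of_hasCanonicalComparison_inv` for `η` versus `η⁻¹`.
[cite: Kim2022StructureSelmer, §2.1.2 and §2.2.2] [cite: Rubin2011, Def. 1.9.4 and Def. 1.9.6 (p. 14)] -/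
theorem fs_eq_fs_of_hasCanonicalComparison {D D' : KolyvaginDatum ρ}
    {η : (q : HeightOneSpectrum (𝓞 ℚ)) → (ZMod (Ideal.absNorm q.asIdeal))ˣ}
    (hD : D.HasCanonicalComparison N η) (hD' : D'.HasCanonicalComparison N η)
    {q : HeightOneSpectrum (𝓞 ℚ)} (hq : q ∈ D.primes) (hq' : q ∈ D'.primes)
    (hur : GaloisRep.IsUnramifiedAt q ρ)
    {x : galoisCohomology (GaloisRep.toLocal q ρ) 1}
    (hx : x ∈ unramifiedSubgroup (GaloisRep.toLocal q ρ) 1) :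
    D'.fs q x = D.fs q x := by
  have hI : ∀ t ∈ absInertia (q.adicCompletion ℚ), GaloisRep.toLocal q ρ t = 1 := fun t ht =>
    (GaloisRep.isUnramifiedAt_iff_toLocal_holds q ρ).1 hur t ht
  obtain ⟨φ, hφ⟩ := exists_isAbsArithFrob_holds (F := q.adicCompletion ℚ)
  exact fs_eq_fs_of_isFiniteSingularComparisonWith (GaloisRep.toLocal q ρ) N hI
    (localNormCyclotomicCharacter q) (hD.zpowers_eq_top hq)
    (KSDevissage.exists_absInertia_localNormCyclotomicCharacter_eq q (η q)) φ
    (fun t ht hχt => hD.at hq hφ ht hχt) (fun t ht hχt => hD'.at hq' hφ ht hχt) hx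

end Rat

section Transfer
variable {K : Type u} [Field K] [NumberField K]
variable {M : Type u} [AddCommGroup M] [TopologicalSpace M] [DiscreteTopology M]
variable {ρ : DiscreteGaloisModule K M}

/-- **Kolyvagin systems restrict to sub-data whose comparison maps agree with the datum's ON `H¹_ur`**
(sharpening T-KS-RES `KSRestrict.isKolyvaginSystem_of_primes_subset`, which asked for EQUAL maps):
`𝒫(D′) ⊆ 𝒫(D)`, same transverse conditions, `𝓕_𝔮 ≤ H¹_ur` and `D′.fs_𝔮 = D.fs_𝔮` on `H¹_ur` at
`𝔮 ∈ 𝒫(D′)`; in the relation `v_𝔮(κ_{d𝔮}) = φ^{fs}_𝔮(loc_𝔮 κ_d)`, `𝔮 ∉ d`, the class `loc_𝔮 κ_d`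
lies in `𝓕(d)_𝔮 = 𝓕_𝔮 ≤ H¹_ur`. [cite: Sakamoto2024, Def. 4.1 (p. 926)] [cite: Rubin2011, Def. 2.2.1 (p. 18)] -/
theorem isKolyvaginSystem_of_primes_subset_of_eqOn_unramified {D D' : KolyvaginDatum ρ}
    {𝓕 : SelmerStructure ρ} {κ κ' : Finset (HeightOneSpectrum (𝓞 K)) → galoisCohomology ρ 1}
    (hκ : D.IsKolyvaginSystem 𝓕 κ) (hPP : D'.primes ⊆ D.primes)
    (hT : D'.transverse = D.transverse)
    (h𝓕 : ∀ q ∈ D'.primes, 𝓕 (Sum.inr q) ≤ unramifiedSubgroup (GaloisRep.toLocal q ρ) 1)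
    (hfs : ∀ q ∈ D'.primes, ∀ x ∈ unramifiedSubgroup (GaloisRep.toLocal q ρ) 1,
      D'.fs q x = D.fs q x)
    (hon : ∀ d, D'.IsLevel d → κ' d = κ d) (hoff : ∀ d, ¬ D'.IsLevel d → κ' d = 0) :
    D'.IsKolyvaginSystem 𝓕 κ' where
  eq_zero_of_not_isLevel := hoff
  mem_selmerGroup d hd := by
    rw [hon d hd, KSRestrict.atLevel_eq_of_transverse_eq hT]
    exact hκ.mem_selmerGroup d (KSRestrict.isLevel_of_primes_subset hPP hd)
  fs_rel d hd q hq hqd := by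
    have hdD : D.IsLevel d := KSRestrict.isLevel_of_primes_subset hPP hd
    -- `loc_𝔮 κ_d ∈ 𝓕(d)_𝔮 = 𝓕_𝔮 ≤ H¹_ur`
    have hx : galoisCohomology.localization ρ (Sum.inr q) 1 (κ d) ∈
        unramifiedSubgroup (GaloisRep.toLocal q ρ) 1 := by
      have h : galoisCohomology.localization ρ (Sum.inr q) 1 (κ d) ∈
          𝓕.modify D.transverse ∅ ∅ d (Sum.inr q) :=
        (SelmerStructure.mem_selmerGroup_iff _ _).1 (hκ.mem_selmerGroup d hdD) (Sum.inr q)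
      rw [SelmerStructure.modify_inr_of_not_mem _ _ (Finset.notMem_empty q) (Finset.notMem_empty q)
        hqd] at h
      exact h𝓕 q hq h
    have hloc : D'.fsLocalization q (κ d) = D.fsLocalization q (κ d) := by
      simp only [KolyvaginDatum.fsLocalization, AddMonoidHom.coe_comp, Function.comp_apply]
      exact hfs q hq _ hx
    rw [hon _ (hd.insert hq), hon d hd, hloc]
    exact hκ.fs_rel d hdD q (hPP hq) hqd

/-- **(COMP) for two data with DISJOINT prime sets is EXACTLY the agreement of the bottom classes**:
the only common level is `1 = ∅`, so reduction compatibility at `k = k′`, `red = id` says precisely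
`κu_1 = κ_1 ∧ κu′_1 = κ′_1` (both families start from Kato's `z_ℚ mod 3^{k+1}` in the intended
model) — nothing a local lever could contradict. [cite: MazurRubin2004, Def. 3.1.3] -/
theorem comp_id_iff_apply_empty_of_disjoint {D₁ D₂ : KolyvaginDatum ρ}
    (hdisj : Disjoint D₁.primes D₂.primes)
    (κ κ' κu κu' : Finset (HeightOneSpectrum (𝓞 K)) → galoisCohomology ρ 1) :
    (∀ d, D₂.IsLevel d → D₁.IsLevel d →
        galoisCohomology.map
            (ContIntertwiningMap.id : ρ.toContRepresentation →ⁱL ρ.toContRepresentation) 1 (κu d) =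
          κ d ∧
        galoisCohomology.map
            (ContIntertwiningMap.id : ρ.toContRepresentation →ⁱL ρ.toContRepresentation) 1 (κu' d) =
          κ' d) ↔
      (κu ∅ = κ ∅ ∧ κu' ∅ = κ' ∅) := by
  constructor
  · intro h
    have h0 := h ∅ D₂.isLevel_empty D₁.isLevel_empty
    rwa [IdPair.map_id_one_apply, IdPair.map_id_one_apply] at h0
  · rintro ⟨h1, h2⟩ d hd₂ hd₁
    have hd : d = ∅ := Finset.coe_eq_empty.mp
      (Set.eq_empty_of_subset_empty fun x hx => Set.disjoint_iff.mp hdisj ⟨hd₁ hx, hd₂ hx⟩)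
    subst hd
    rw [IdPair.map_id_one_apply, IdPair.map_id_one_apply]
    exact ⟨h1, h2⟩

end Transfer

section Witness
variable {W : WeierstrassCurve ℚ} [W.IsElliptic] [W.IsGloballyMinimal]

/-- Local notation: the depth-`k` module `E[3^k·3]` in the PORT's spelling. -/
local notation3 "ρ[" k "]" => WeierstrassCurve.torsionGaloisModule W (((3 : ℕ) : ℤ) ^ k * ((3 : ℕ) : ℤ))

omit [W.IsGloballyMinimal] in
/-- **`E[3^{k+1}]` is unramified at a good place `𝔮 ∤ 3`** (Silverman VII.4.1 (a), through the
tree's `smul_geomTorsion_eq_of_mem_inertia`). [cite: SilvermanAEC2009, Prop. VII.4.1(a)] -/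
theorem isUnramifiedAt_torsion_pow_mul {k : ℕ} {q : HeightOneSpectrum (𝓞 ℚ)}
    (hgood : W.HasGoodReductionAt q) (h3 : ((3 : ℕ) : 𝓞 ℚ) ∉ q.asIdeal) :
    GaloisRep.IsUnramifiedAt q (ρ[k]) := by
  have hn : (((((3 : ℕ) : ℤ) ^ k * ((3 : ℕ) : ℤ) : ℤ)) : 𝓞 ℚ) ∉ q.asIdeal := by
    intro h
    rw [Int.cast_mul, Int.cast_pow, Int.cast_natCast] at h
    rcases q.isPrime.mem_or_mem h with h | h
    · exact h3 (q.isPrime.mem_of_pow_mem k h)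
    · exact h3 h
  intro 𝔓 h𝔓 τ hτ
  refine LinearMap.ext fun P => ?_
  exact W.smul_geomTorsion_eq_of_mem_inertia hgood hn h𝔓 hτ P

omit [W.IsElliptic] [W.IsGloballyMinimal] in
/-- **At `k = k′` the pinned reduction map IS the identity** (`(red x : E(ℚ̄)) = 3^{k−k} • x` forces
`red = id`), so every equal-depth instance of PORT′ / PORT″ is the `red = id` instance. [folklore] -/
theorem eq_id_of_pin {k : ℕ}
    {red : (ρ[k]).toContRepresentation →ⁱL (ρ[k]).toContRepresentation}
    (hred : ∀ x : geomTorsion W (((3 : ℕ) : ℤ) ^ k * ((3 : ℕ) : ℤ)),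
      ((red x : geomTorsion W (((3 : ℕ) : ℤ) ^ k * ((3 : ℕ) : ℤ))) : geomPoints W) =
        (((3 : ℕ) : ℤ) ^ (k - k)) • (x : geomPoints W)) :
    red = ContIntertwiningMap.id :=
  DFunLike.ext red _ fun x => Subtype.ext (by
    have h := hred x
    rwa [Nat.sub_self, pow_zero, one_smul] at h)

/-- **The witness clauses of DICT3 @ 3 pass from a datum to a sub-datum** with the SAME `κ`, the SAME
`Λ` and `κ′` restricted: `𝒫(D′) ⊆ 𝒫(D)` (good, prime to `3`), same transverse conditions, comparison
maps agreeing with `D`'s on `H¹_ur`.  (0), (DICT3) are "for every level" clauses and levels of `D′` are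
levels of `D`; (Λ) does not mention the datum; (I4) is §3 with `𝓕_can,𝔮 = H¹_ur` at good `𝔮 ∤ 3`.
[cite: Kim2022StructureSelmer, Thm. 3.13 and §2.2.2] [cite: MazurRubin2004, Thm. 3.2.4 and App. A (33)] -/
theorem katoKuriharaWitnessAt_of_primes_subset {k t : ℕ} {D D' : KolyvaginDatum (ρ[k])}
    {v₃ : HeightOneSpectrum (𝓞 ℚ)} {N : ℕ} [NeZero N] {P : ModularParametrizationData W N}
    {κ : Finset (HeightOneSpectrum (𝓞 ℚ)) → galoisCohomology (ρ[k]) 1}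
    {Λ : galoisCohomology ((ρ[k]).toLocal (Sum.inr v₃)) 1 →+ ZMod (3 ^ (k + 1))}
    {κ' : Finset (HeightOneSpectrum (𝓞 ℚ)) → galoisCohomology (ρ[k]) 1}
    (h : KatoKuriharaWitnessAt W k t D v₃ P κ Λ κ')
    (hPP : D'.primes ⊆ D.primes) (hT : D'.transverse = D.transverse)
    (hgood : ∀ q ∈ D'.primes, W.HasGoodReductionAt q ∧ ((3 : ℕ) : 𝓞 ℚ) ∉ q.asIdeal)
    (hfs : ∀ q ∈ D'.primes, ∀ x ∈ unramifiedSubgroup (GaloisRep.toLocal q (ρ[k])) 1,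
      D'.fs q x = D.fs q x) :
    KatoKuriharaWitnessAt W k t D' v₃ P κ Λ (fun d => if D'.IsLevel d then κ' d else 0) := by
  obtain ⟨h0, ⟨hKS, hbr⟩, hon, hker, hdict⟩ := h
  refine ⟨fun d hd => ?_, ⟨?_, fun d hd => ?_⟩, hon, hker,
    fun d hd => hdict d (KSRestrict.isLevel_of_primes_subset hPP hd)⟩
  · rw [KSRestrict.atLevel_eq_of_transverse_eq hT]
    exact h0 d (KSRestrict.isLevel_of_primes_subset hPP hd)
  · refine (KolyvaginDatum.mem_kolyvaginSystems_iff _ _ _).2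
      (isKolyvaginSystem_of_primes_subset_of_eqOn_unramified
        ((KolyvaginDatum.mem_kolyvaginSystems_iff _ _ _).1 hKS) hPP hT (fun q hq => ?_) hfs
        (fun _ hd => if_pos hd) fun _ hd => if_neg hd)
    exact (propagatedSelmerStructure_inr_eq_unramifiedSubgroup W 3 k (hgood q hq).2 (hgood q hq).1).le
  · simp only [if_pos hd]
    exact hbr d (KSRestrict.isLevel_of_primes_subset hPP hd)

/-- ★★★ **DICT3 at ONE datum gives the two-level dictionary DICT3₂ at equal depth for ANY two of its
sub-data and EVERY `red`** (sub-data: primes inside `𝒫(D)`, all good and prime to `3`; same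
transverse conditions; comparison maps agreeing with `D`'s on `H¹_ur`): the pin makes `red = id`,
the witnesses are `(κ, Λ, κ′|_{D₁})`, `(κ, Λ, κ′|_{D₂})` from ONE witness for `D` (§4), and (COMP)
compares one family with itself.  Relative consistency for the referee's case (b) (`D₁ = D` or
`D₂ = D`) and case (a) inside a common datum.
[cite: Kim2022StructureSelmer, Thm. 3.13 and §2.2.2] [cite: MazurRubin2004, Def. 3.1.3 and Thm. 3.2.4] -/
theorem dictionaryThreeAt₂_of_dictionaryThreeAt {k t : ℕ} {D D₁ D₂ : KolyvaginDatum (ρ[k])}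
    {v₃ : HeightOneSpectrum (𝓞 ℚ)} (h : KatoKuriharaDictionaryThreeAt W k t D v₃)
    (h₁P : D₁.primes ⊆ D.primes) (h₁T : D₁.transverse = D.transverse)
    (h₂P : D₂.primes ⊆ D.primes) (h₂T : D₂.transverse = D.transverse)
    (hgood : ∀ q ∈ D.primes, W.HasGoodReductionAt q ∧ ((3 : ℕ) : 𝓞 ℚ) ∉ q.asIdeal)
    (h₁fs : ∀ q ∈ D₁.primes, ∀ x ∈ unramifiedSubgroup (GaloisRep.toLocal q (ρ[k])) 1,
      D₁.fs q x = D.fs q x)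
    (h₂fs : ∀ q ∈ D₂.primes, ∀ x ∈ unramifiedSubgroup (GaloisRep.toLocal q (ρ[k])) 1,
      D₂.fs q x = D.fs q x)
    (red : (ρ[k]).toContRepresentation →ⁱL (ρ[k]).toContRepresentation) :
    KatoKuriharaDictionaryThreeAt₂ W t k k D₁ D₂ red v₃ := by
  intro _hk hred hadd hc3 hsurj ht hv₃ N _ P hcP hper
  obtain rfl : red = ContIntertwiningMap.id := eq_id_of_pin hred
  obtain ⟨κ, Λ, h0, ⟨⟨κ', hKS⟩, hbr⟩, hon, hker, hdict⟩ := h hadd hc3 hsurj ht hv₃ P hcP hper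
  have hW : KatoKuriharaWitnessAt W k t D v₃ P κ Λ κ' := ⟨h0, ⟨hKS, hbr⟩, hon, hker, hdict⟩
  refine ⟨κ, Λ, fun d => if D₁.IsLevel d then κ' d else 0, κ, Λ,
    fun d => if D₂.IsLevel d then κ' d else 0,
    katoKuriharaWitnessAt_of_primes_subset hW h₁P h₁T (fun q hq => hgood q (h₁P hq)) h₁fs,
    katoKuriharaWitnessAt_of_primes_subset hW h₂P h₂T (fun q hq => hgood q (h₂P hq)) h₂fs,
    fun d hd₂ hd₁ => ⟨IdPair.map_id_one_apply _ _, ?_⟩⟩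
  rw [IdPair.map_id_one_apply]
  simp only [if_pos hd₁, if_pos hd₂]

/-- ★★★ **The referee's second check, With-guarded form**: `D` With-guarded for `η` at depth `k`
(any class depth `m`) with DICT3, and `D₁, D₂ ⊆ D` With-guarded for THE SAME `η` at depth `k` (any
`m₁, m₂`) ⟹ `KatoKuriharaDictionaryThreeAt₂ W t k k D₁ D₂ red v₃` for every `red` — (datum,
sub-datum) pairs in both orientations (`subset_rfl`) and (same `η`, different prime sets in one
class) pairs.  The guards supply the common cyclotomic transverse conditions, good primes prime to
`3` (the `S`-clause), and — by ★ §2 with `E[3^{k+1}]` unramified there — maps agreeing on `H¹_ur`.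
[cite: Kim2022StructureSelmer, Thm. 3.13 and §2.2.2] [cite: Sakamoto2024, §2 and Def. 4.1] -/
theorem dictionaryThreeAt₂_of_dictionaryThreeAt_of_with {k t m m₁ m₂ : ℕ}
    {η : (q : HeightOneSpectrum (𝓞 ℚ)) → (ZMod (Ideal.absNorm q.asIdeal))ˣ}
    {D D₁ D₂ : KolyvaginDatum (ρ[k])} {v₃ : HeightOneSpectrum (𝓞 ℚ)}
    (h : KatoKuriharaDictionaryThreeAt W k t D v₃) (hD : D.IsCanonicalTauDatumThreeAtWith W m k η)
    (hD₁ : D₁.IsCanonicalTauDatumThreeAtWith W m₁ k η) (h₁P : D₁.primes ⊆ D.primes)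
    (hD₂ : D₂.IsCanonicalTauDatumThreeAtWith W m₂ k η) (h₂P : D₂.primes ⊆ D.primes)
    (red : (ρ[k]).toContRepresentation →ⁱL (ρ[k]).toContRepresentation) :
    KatoKuriharaDictionaryThreeAt₂ W t k k D₁ D₂ red v₃ := by
  obtain ⟨hT, hC, S, τ, hS, -, -, hP⟩ := hD
  have hgood : ∀ q ∈ D.primes, W.HasGoodReductionAt q ∧ ((3 : ℕ) : 𝓞 ℚ) ∉ q.asIdeal :=
    fun q hq => hS q (hP hq).1
  refine dictionaryThreeAt₂_of_dictionaryThreeAt h h₁P (hD₁.1.trans hT.symm) h₂P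
    (hD₂.1.trans hT.symm) hgood (fun q hq x hx => ?_) (fun q hq x hx => ?_) red
  · exact fs_eq_fs_of_hasCanonicalComparison hC hD₁.2.1 (h₁P hq) hq
      (isUnramifiedAt_torsion_pow_mul (hgood q (h₁P hq)).1 (hgood q (h₁P hq)).2) hx
  · exact fs_eq_fs_of_hasCanonicalComparison hC hD₂.2.1 (h₂P hq) hq
      (isUnramifiedAt_torsion_pow_mul (hgood q (h₂P hq)).1 (hgood q (h₂P hq)).2) hx

/-- **PORT″ form** (the `P`-keyed two-level dictionary `KatoKuriharaDictionaryThreeAt₂At … P` of the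
re-key spec): the same instances at every parametrisation datum `P`, by projection.
[cite: Kim2022StructureSelmer, Thm. 3.13] -/
theorem dictionaryThreeAt₂At_of_dictionaryThreeAt_of_with {k t m m₁ m₂ : ℕ}
    {η : (q : HeightOneSpectrum (𝓞 ℚ)) → (ZMod (Ideal.absNorm q.asIdeal))ˣ}
    {D D₁ D₂ : KolyvaginDatum (ρ[k])} {v₃ : HeightOneSpectrum (𝓞 ℚ)}
    (h : KatoKuriharaDictionaryThreeAt W k t D v₃) (hD : D.IsCanonicalTauDatumThreeAtWith W m k η)
    (hD₁ : D₁.IsCanonicalTauDatumThreeAtWith W m₁ k η) (h₁P : D₁.primes ⊆ D.primes)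
    (hD₂ : D₂.IsCanonicalTauDatumThreeAtWith W m₂ k η) (h₂P : D₂.primes ⊆ D.primes)
    (red : (ρ[k]).toContRepresentation →ⁱL (ρ[k]).toContRepresentation)
    {N : ℕ} [NeZero N] (P : ModularParametrizationData W N) :
    KatoKuriharaDictionaryThreeAt₂At W t k k D₁ D₂ red v₃ P :=
  (dictionaryThreeAt₂_of_dictionaryThreeAt_of_with h hD hD₁ h₁P hD₂ h₂P red).at P

/-- **Conversely, PORT′ gives DICT3 back at every With-guarded datum** (the diagonal instance
`k = k′`, `D′ = D`, `red = id`; `katoKuriharaDictionaryThreeAt_of_two`).  So on nested / co-classed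
equal-depth pairs PORT′ and the single-datum dictionary have THE SAME content.
[cite: Kim2022StructureSelmer, Thm. 3.13] -/
theorem dictionaryThreeAt_of_portWith {t k : ℕ} {v₃ : HeightOneSpectrum (𝓞 ℚ)}
    {η : (q : HeightOneSpectrum (𝓞 ℚ)) → (ZMod (Ideal.absNorm q.asIdeal))ˣ}
    (h : KatoKuriharaPortThreeAtWith W t v₃ η) {D : KolyvaginDatum (ρ[k])}
    (hD : D.IsCanonicalTauDatumThreeAtWith W (k + t) k η) : KatoKuriharaDictionaryThreeAt W k t D v₃ :=
  katoKuriharaDictionaryThreeAt_of_two (h k k D D ContIntertwiningMap.id hD hD) le_rfl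
    fun x => by simp only [Nat.sub_self, pow_zero, one_smul]; rfl

/-- ★★ **A UNIFORM witness — ONE family `(κ, Λ, κ′)` serving every datum With-guarded for `η` at
depth `k` (the shape of Kato's derivative family `κ_n^{η}` for a FIXED `η`, [Kim22] §2.2.2: the
classes depend on `η` and `n`, not on an ambient prime set) — gives EVERY equal-depth instance of
PORT′ `η`, disjoint classes included**: (COMP) compares one family with itself.  With §5 this locates
PORT′'s content at `k = k′` beyond DICT3: the GLUING of families across data — Euler-system content
no clause of the predicate can contradict. [cite: Kim2022StructureSelmer, §2.2.2 and Thm. 3.13] -/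
theorem dictionaryThreeAt₂_of_uniform {k t : ℕ} {v₃ : HeightOneSpectrum (𝓞 ℚ)}
    {η : (q : HeightOneSpectrum (𝓞 ℚ)) → (ZMod (Ideal.absNorm q.asIdeal))ˣ}
    (hU : haveI : Fact (Nat.Prime 3) := ⟨Nat.prime_three⟩;
      Addv W 3 → ¬ 3 ∣ (W.baseChange ℚ_[3]).localTamagawaNumber ℤ_[3] →
      W.HasSurjectiveModNGaloisRep ((3 : ℕ) : ℤ) →
      Nat.card {Q : (W.baseChange ℚ_[3]).toAffine.Point // (3 : ℕ) • Q = 0} = 3 ^ t →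
      ((3 : ℕ) : 𝓞 ℚ) ∈ v₃.asIdeal →
      ∀ {N : ℕ} [NeZero N] (P : ModularParametrizationData W N),
        ¬ ((3 : ℕ) : ℤ) ∣ P.maninConstant →
        (∃ u : ℚ, ‖(u : ℚ_[3])‖ = 1 ∧ W.realPeriodRat = u * plusPeriod P.f) →
        ∃ (κ : Finset (HeightOneSpectrum (𝓞 ℚ)) → galoisCohomology (ρ[k]) 1)
          (Λ : galoisCohomology ((ρ[k]).toLocal (Sum.inr v₃)) 1 →+ ZMod (3 ^ (k + 1)))
          (κ' : Finset (HeightOneSpectrum (𝓞 ℚ)) → galoisCohomology (ρ[k]) 1),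
          ∀ (m : ℕ) (D : KolyvaginDatum (ρ[k])), D.IsCanonicalTauDatumThreeAtWith W m k η →
            KatoKuriharaWitnessAt W k t D v₃ P κ Λ (fun d => if D.IsLevel d then κ' d else 0))
    {m₁ m₂ : ℕ} {D₁ D₂ : KolyvaginDatum (ρ[k])}
    (hD₁ : D₁.IsCanonicalTauDatumThreeAtWith W m₁ k η) (hD₂ : D₂.IsCanonicalTauDatumThreeAtWith W m₂ k η)
    (red : (ρ[k]).toContRepresentation →ⁱL (ρ[k]).toContRepresentation) :
    KatoKuriharaDictionaryThreeAt₂ W t k k D₁ D₂ red v₃ := by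
  intro _hk hred hadd hc3 hsurj ht hv₃ N _ P hcP hper
  obtain rfl : red = ContIntertwiningMap.id := eq_id_of_pin hred
  obtain ⟨κ, Λ, κ', hW⟩ := hU hadd hc3 hsurj ht hv₃ P hcP hper
  refine ⟨κ, Λ, fun d => if D₁.IsLevel d then κ' d else 0, κ, Λ,
    fun d => if D₂.IsLevel d then κ' d else 0, hW m₁ D₁ hD₁, hW m₂ D₂ hD₂,
    fun d hd₂ hd₁ => ⟨IdPair.map_id_one_apply _ _, ?_⟩⟩
  rw [IdPair.map_id_one_apply]
  simp only [if_pos hd₁, if_pos hd₂]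

end Witness

end Summit.BirchSwinnertonDyer.Rank1Residual.GaloisImage.PortCheck

end
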